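import Summits.Parity.BatemanHorn.Theorems.SelbergDelangeRigidityLSDRealSegmentConclusionLow
import HarnessLib

/-!
# Route `SelbergDelangeRigidity`, crux `LSDRealSegment` (stmt-Parity-9770): glue of the split by total degree
# (crux-strategist decomposition, frame form)

The crux `Summit.Parity.BatemanHorn.Theses.SelbergDelangeRigidity.LSDRealSegment` quantifies over every
Bateman–Horn system `f = (f₁,…,f_k)`.  By `IsBatemanHornSystem.natDegree_pos` every member has degree `≥ 1`,
so the total degree `T = Σ deg fᵢ` sorts the systems into four classes:

* `T ≤ 1` — the empty system and one linear form: the crux's conclusion is a THEOREM of the tree,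
  `ProductAnatomySubcritical.lsdRealSegment_of_sum_natDegree_le_one` (p111579: `Λ = eulerFactor f`, the
  landed Type-I law `stub_typeI`, Euler factor `stub_eulerFactor` and the vanishing kernel law);
* `T = 2, k = 1` — ONE IRREDUCIBLE QUADRATIC (child `QuadraticSegmentLaw`);
* `T = 2, k = 2` — TWO LINEAR FORMS (child `LinearPairSegmentLaw`);
* `T ≥ 3` — everything else (child `HighDegreeSegmentLaw`).

`lsdRealSegment_of_subs` is the implication `QuadraticSegmentLaw → LinearPairSegmentLaw → HighDegreeSegmentLaw →
LSDRealSegment`, pure logic plus the landed `T ≤ 1` theorem.  FRAME FORM: this module must be importable by the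
route module `Summits.Parity.BatemanHorn.Theses.SelbergDelangeRigidity` (the gate renders
`theorem LSDRealSegmentGlueBy_holds : QuadraticSegmentLaw → LinearPairSegmentLaw → HighDegreeSegmentLaw →
LSDRealSegment := _root_.…lsdRealSegment_of_subs` there), so it does NOT import the route module and states all
four statements with their bodies INLINED VERBATIM (the crux body copied from the route file rev 1; the three
children are that body under the extra hypotheses `k = 1 ∧ T = 2`, `k = 2 ∧ T = 2`, `3 ≤ T`); the rendered link
then typechecks by `δ`-unfolding only.  The same split was typed and proved against the route decl by name in
`Cruxes/LSDRealSegment/Ideator5R2Sketch.lean` (crux-ideate round 2, ideator 5; re-checked by both round-2 triagers).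
No definitions, nothing conditional, no analysis.
-/

open Filter Finset Polynomial
open scoped BigOperators Topology Classical

namespace Summit.Parity.BatemanHorn.Theorems

open Literature.NumberTheory.Sieve

/-- **Glue of the split of `LSDRealSegment` by total degree** (crux-strategist, 2026-08-17).
Hypotheses, in order: the real-segment Landau–Selberg–Delange law along `f` (the crux body, verbatim) for
(1) one irreducible quadratic (`k = 1`, `Σ deg = 2`), (2) two linear forms (`k = 2`, `Σ deg = 2`),
(3) every Bateman–Horn system of total degree `≥ 3`; conclusion: the crux body for EVERY Bateman–Horn system.
Proof: case split on `T = Σ deg fᵢ`; `T ≤ 1` is the landed theorem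
`ProductAnatomySubcritical.lsdRealSegment_of_sum_natDegree_le_one`; `T = 2` forces `k ∈ {1, 2}` because every
member has positive degree (`IsBatemanHornSystem.natDegree_pos`). [folklore] -/
theorem lsdRealSegment_of_subs
    (hQ : ∀ (k : ℕ) (f : Fin k → Polynomial ℤ), Literature.NumberTheory.Sieve.IsBatemanHornSystem f → k = 1 →
      (∑ i, (f i).natDegree) = 2 → ∃ Λ : ℂ → ℂ, DifferentiableOn ℂ Λ (Metric.ball 0 2) ∧
      Λ 0 = (Literature.NumberTheory.Sieve.batemanHornConst f : ℂ) ∧ ∀ y : ℝ, 5 / 4 < y → y < 7 / 4 →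
      Filter.Tendsto (fun x : ℕ => (x : ℂ)⁻¹ * Complex.exp ((k : ℂ) * (1 - (y : ℂ)) * (Real.log (Real.log x) : ℂ)) *
        ∑ n ∈ Finset.range (x + 1), (y : ℂ) ^ (∑ i, ArithmeticFunction.cardFactors (((f i).eval (n : ℤ)).toNat)))
        Filter.atTop (nhds (Λ y * Complex.exp (((y : ℂ) - 1) * (Real.log (∏ i, ((f i).natDegree : ℝ)) : ℂ)) *
        (Complex.Gamma y)⁻¹ ^ k)))
    (hP : ∀ (k : ℕ) (f : Fin k → Polynomial ℤ), Literature.NumberTheory.Sieve.IsBatemanHornSystem f → k = 2 →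
      (∑ i, (f i).natDegree) = 2 → ∃ Λ : ℂ → ℂ, DifferentiableOn ℂ Λ (Metric.ball 0 2) ∧
      Λ 0 = (Literature.NumberTheory.Sieve.batemanHornConst f : ℂ) ∧ ∀ y : ℝ, 5 / 4 < y → y < 7 / 4 →
      Filter.Tendsto (fun x : ℕ => (x : ℂ)⁻¹ * Complex.exp ((k : ℂ) * (1 - (y : ℂ)) * (Real.log (Real.log x) : ℂ)) *
        ∑ n ∈ Finset.range (x + 1), (y : ℂ) ^ (∑ i, ArithmeticFunction.cardFactors (((f i).eval (n : ℤ)).toNat)))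
        Filter.atTop (nhds (Λ y * Complex.exp (((y : ℂ) - 1) * (Real.log (∏ i, ((f i).natDegree : ℝ)) : ℂ)) *
        (Complex.Gamma y)⁻¹ ^ k)))
    (hH : ∀ (k : ℕ) (f : Fin k → Polynomial ℤ), Literature.NumberTheory.Sieve.IsBatemanHornSystem f →
      3 ≤ (∑ i, (f i).natDegree) → ∃ Λ : ℂ → ℂ, DifferentiableOn ℂ Λ (Metric.ball 0 2) ∧
      Λ 0 = (Literature.NumberTheory.Sieve.batemanHornConst f : ℂ) ∧ ∀ y : ℝ, 5 / 4 < y → y < 7 / 4 →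
      Filter.Tendsto (fun x : ℕ => (x : ℂ)⁻¹ * Complex.exp ((k : ℂ) * (1 - (y : ℂ)) * (Real.log (Real.log x) : ℂ)) *
        ∑ n ∈ Finset.range (x + 1), (y : ℂ) ^ (∑ i, ArithmeticFunction.cardFactors (((f i).eval (n : ℤ)).toNat)))
        Filter.atTop (nhds (Λ y * Complex.exp (((y : ℂ) - 1) * (Real.log (∏ i, ((f i).natDegree : ℝ)) : ℂ)) *
        (Complex.Gamma y)⁻¹ ^ k))) :
    ∀ (k : ℕ) (f : Fin k → Polynomial ℤ), Literature.NumberTheory.Sieve.IsBatemanHornSystem f →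
      ∃ Λ : ℂ → ℂ, DifferentiableOn ℂ Λ (Metric.ball 0 2) ∧
      Λ 0 = (Literature.NumberTheory.Sieve.batemanHornConst f : ℂ) ∧ ∀ y : ℝ, 5 / 4 < y → y < 7 / 4 →
      Filter.Tendsto (fun x : ℕ => (x : ℂ)⁻¹ * Complex.exp ((k : ℂ) * (1 - (y : ℂ)) * (Real.log (Real.log x) : ℂ)) *
        ∑ n ∈ Finset.range (x + 1), (y : ℂ) ^ (∑ i, ArithmeticFunction.cardFactors (((f i).eval (n : ℤ)).toNat)))
        Filter.atTop (nhds (Λ y * Complex.exp (((y : ℂ) - 1) * (Real.log (∏ i, ((f i).natDegree : ℝ)) : ℂ)) *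
        (Complex.Gamma y)⁻¹ ^ k)) := by
  intro k f hf
  rcases Nat.lt_or_ge (∑ i, (f i).natDegree) 3 with hlt | hge
  · rcases Nat.lt_or_ge (∑ i, (f i).natDegree) 2 with hlt2 | hge2
    · -- total degree ≤ 1: the landed theorem (p111579)
      exact Summit.Parity.BatemanHorn.Cruxes.LSDRealSegment.ProductAnatomySubcritical.lsdRealSegment_of_sum_natDegree_le_one
        k f hf (by omega)
    · -- total degree = 2: `k = 1` (one quadratic) or `k = 2` (two linear forms)
      have h2 : (∑ i, (f i).natDegree) = 2 := by omega
      have hpos : ∀ i, 1 ≤ (f i).natDegree := fun i => hf.natDegree_pos i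
      have hk_le : k ≤ 2 := by
        have : (∑ _i : Fin k, (1 : ℕ)) ≤ ∑ i, (f i).natDegree := Finset.sum_le_sum fun i _ => hpos i
        simpa [h2] using this
      have hk_pos : 1 ≤ k := by
        by_contra hk0
        have hk : k = 0 := by omega
        subst hk
        simp at h2
      rcases (show k = 1 ∨ k = 2 by omega) with hk1 | hk2
      · exact hQ k f hf hk1 h2
      · exact hP k f hf hk2 h2
  · exact hH k f hf hge

end Summit.Parity.BatemanHorn.Theorems
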